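import Summits.FinalStateConjecture.FinalStateConjecture.Theorems.StarvedNecksGapDecaySufficesStubAssembly
import Summits.FinalStateConjecture.FinalStateConjecture.Theorems.StarvedNecksGapDecaySufficesStubAssemblyDefsV10

/-!
# Stub `stub_assembly` (S5 of line `Sketch`, crux `GapDecaySuffices`) — skeleton v10: the S3-AGNOSTIC assembly

`assembly_of_core` re-proves the landed v8/v9 reduction `…Assembly.assembly_of_A_B_C` (p168243) in the form the
skeleton v10 of lead c2 consumes:

* the analytic core is an ARBITRARY `S3 : Prop` — (A) is taken as `FlatFarCertified → S3 → PerHoleRegaugeCore`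
  and `S3` is only threaded through to it, so that reshaping the inward switch-off (`…V10.SwitchOffInward`,
  F13, or any later form) never touches this file again;
* label matching outputs, and S4 consumes, the CLOCK-WINDOWED anchoring `TubeAnchoredClockR` (v10, F11);
  (B) keeps the v9 `TubeAnchoredR`, fed by the projection `tubeAnchoredR_of_clock`.

The proof is the landed one verbatim up to these two edits (per hole: S4's kinematic majorant, the profile from
(C), S1's certificate for the majorant `16ρ'`, S4 five times via `located_iterate`, (A); then `relabelEach` and
(B)).  0 sorries, standard axioms.
-/

noncomputable section

open scoped Manifold ContDiff Topology ENNReal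
open Filter Set Topology Literature.Geometry.Lorentzian

namespace Summit.FinalStateConjecture.FinalStateConjecture.Theorems.GapDecaySuffices.V10

-- justified lint debt: the problem namespace repeats the summit name (`FinalStateConjecture.FinalStateConjecture`)
set_option linter.dupNamespace false

open Location.AnchoredV2 (HonestCore HonestFar DistinctVelocities TubeAnchoredR)
open Relabel (ParityDatum relabelMotion relabelChart relabelEach)
open Assembly (FlatFarCertified pullbackMinus GapCert Located AdmissibleProfile SingleHoleCert GapBootstrap
  CertificateBookkeeping ConcaveDominator WeakCertificateAfterRelabelling located_iterate
  flatTubesClosed_relabelEach)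

/-- **S5 reduced, v10 (S3-agnostic, clock-windowed anchoring).**  For any analytic core `S3`, the per-hole
re-gauge in core form fed by S2 and `S3`, the cross-hole bookkeeping (B) and the concave dominator (C) give:
S1 → S2 → S3 → S4 (v10) → LM (v10) → the parity-safe certificate after relabelling. -/
theorem assembly_of_core {S3 : Prop} (hA : FlatFarCertified → S3 → PerHoleRegaugeCore)
    (hB : CertificateBookkeeping) (hC : ConcaveDominator) :
    GapBootstrap → FlatFarCertified → S3 → AnchoredLocationP → LabelMatching →
      WeakCertificateAfterRelabelling := by
  intro hS1 hS2 hS3 hS4 hLM X _ _ _ _ D hD 𝒟 h𝒟 O d R₀ hO hc hf hdv _hgap hN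
  -- label matching (v8: same number of holes, eventually non-negative excisions of the output)
  obtain ⟨d', R₀', hch, hNN, -, -, hc', hf', hdv', hanch, hnn⟩ := hLM X D hD 𝒟 h𝒟 O d R₀ hO hc hf hdv
  have hO' : O = exteriorOf 𝒟.toCauchyDevelopment d'.charted := by rw [hch]; exact hO
  have hA' := hA hS2 hS3
  -- per-hole data
  have key : ∀ i : Fin d'.N, ∃ (ρ' : ℝ → ℝ) (τm R₁ τ₁ τ₂ : ℝ) (W κ : ℝ → ℝ)
      (Ψg : (d'.background i).domain → 𝒟.carrier) (P : ParityDatum (d'.motion i).1) (τn : ℝ)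
      (Rc κ' : ℝ → ℝ)
      (Ψa : (boostedKerrBackground (relabelMotion P) (d'.motion i).2 (d'.mass i) (d'.spin i)).domain →
        𝒟.carrier),
      AdmissibleProfile d' R₀' i ρ' τm ∧ GapCert d' R₀' i (fun s ↦ 3 * (16 * ρ' s) + 2) R₁ τ₁ W Ψg ∧
        (τ₁ ≤ τ₂ ∧ Tendsto κ atTop (𝓝 0) ∧ Located d' i ρ' τ₁ W Ψg τ₂ κ (11 / 10) 46) ∧
        SingleHoleCert d' R₀' i P ρ' τ₁ W Ψg τn Rc κ' Ψa := by
    intro i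
    -- S4's kinematic majorant of hole `i` (the anchoring window of hole `i` of `d'` is non-degenerate)
    obtain ⟨Bk, hBk, hloc⟩ := hS4 X D hD 𝒟 h𝒟 O d' R₀' hO' hc' hf' hdv' hanch i (hnn i)
    -- the profile from (C)
    set γ : ℝ := ((d'.motion i).1 : E4 ≃L[ℝ] E4) (E4.basisVector 0) 0 with hγ
    have hγ0 : 0 < γ := (hc'.1 i).2.2
    obtain ⟨ρ', hsm, hmono, hconc, hsub, htop, hfloor, hder, hdom⟩ :=
      hC (fun s ↦ max |Bk s| (d'.excision i s + 1)) (max 1 (R₀' + 2 + |d'.spin i|)) (1 / (4 * γ))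
        (Location.tendsto_max_abs_add_one_div hBk (d'.tendsto_excision_div i)) (by positivity)
    have hone : ∀ s, 1 ≤ ρ' s := fun s ↦ (le_max_left _ _).trans (hfloor s)
    have hρpos : ∀ s, 0 < ρ' s := fun s ↦ one_pos.trans_le (hone s)
    have hdomBk : Tendsto (fun s ↦ Bk s / ρ' s) atTop (𝓝 0) := by
      refine squeeze_zero_norm' ?_ hdom
      filter_upwards with s
      rw [Real.norm_eq_abs, abs_div, abs_of_pos (hρpos s)]
      exact div_le_div_of_nonneg_right (le_max_left _ _) (hρpos s).le
    obtain ⟨τm, hτm⟩ : ∃ τm, ∀ s, τm ≤ s → d'.excision i s + 1 ≤ ρ' s := by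
      obtain ⟨τm, h⟩ := Filter.eventually_atTop.1 (hdom.eventually (gt_mem_nhds one_pos))
      refine ⟨τm, fun s hs ↦ ?_⟩
      have h1 := h s hs
      rw [div_lt_one (hρpos s)] at h1
      linarith [le_max_right |Bk s| (d'.excision i s + 1)]
    have hprof : AdmissibleProfile d' R₀' i ρ' τm := by
      refine ⟨hsm, hmono, hconc, hsub, htop, fun s ↦ ?_,
        fun s ↦ ⟨(le_max_right _ _).trans (hfloor s), hone s⟩, hτm⟩
      have h1 := hder s
      rw [← hγ]
      calc 4 * γ * |deriv ρ' s| ≤ 4 * γ * (1 / (4 * γ)) :=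
            mul_le_mul_of_nonneg_left h1 (by positivity)
        _ = 1 := by field_simp
    -- S1's gap certificate of `d'` at `i` for the majorant `16ρ'`
    have hmaj : ∀ s, τm ≤ s → d'.excision i s ≤ 16 * ρ' s := fun s hs ↦ by
      linarith [hτm s hs, hρpos s]
    have hsub16 : Tendsto (fun s ↦ 16 * ρ' s / s) atTop (𝓝 0) := by
      simpa [mul_div_assoc] using hsub.const_mul 16
    obtain ⟨R₁, τ₁, W, Ψg, hG⟩ :=
      hS1 X D hD 𝒟 h𝒟 O d' R₀' hO' hc' hf' hdv' i (fun s ↦ 16 * ρ' s) τm hmaj hsub16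
    obtain ⟨hR, hτ, hW, hwall, hG1, hG2, hG3, hG4, hG5⟩ := hG
    -- S4 five times
    have hS : ∀ ρ'' : ℝ → ℝ, Monotone ρ'' → Continuous ρ'' → ConcaveOn ℝ (Set.Ici 0) ρ'' →
        Tendsto (fun s ↦ ρ'' s / s) atTop (𝓝 0) → Tendsto (fun s ↦ Bk s / ρ'' s) atTop (𝓝 0) →
        (∀ s, 1 ≤ ρ'' s) → (∀ s, τ₁ ≤ s → 3 * ρ'' s + 2 ≤ W s) →
        ∃ (τ₂ : ℝ) (κ : ℝ → ℝ), τ₁ ≤ τ₂ ∧ Tendsto κ atTop (𝓝 0) ∧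
          Located d' i ρ'' τ₁ W Ψg τ₂ κ (11 / 10) (29 / 10) :=
      fun ρ'' h1 h2 h3 h4 h5 h6 hw ↦
        hloc ρ'' h1 h2 h3 h4 h5 h6 R₁ τ₁ W Ψg hR hτ hW hw hG1 hG2 hG3 hG4 hG5
    obtain ⟨τ₂, κ, hτ₂, hκ, hL⟩ := located_iterate d' i Bk hS 4 ρ' hmono hsm.continuous hconc hsub
      hdomBk hone (fun s hs ↦ by have := hwall s hs; norm_num at this ⊢; linarith)
    have hL' : Located d' i ρ' τ₁ W Ψg τ₂ κ (11 / 10) 46 :=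
      Located.weaken d' i hL (fun s ↦ (hρpos s).le) le_rfl (fun _ ↦ le_rfl) (by norm_num)
    -- (A)
    obtain ⟨P, τn, Rc, κ', Ψa, hshc⟩ := hA' _ O d' R₀' i ρ' τm R₁ τ₁ τ₂ W κ Ψg hc' hf' hdv' hprof
      ⟨hR, hτ, hW, hwall, hG1, hG2, hG3, hG4, hG5⟩ hτ₂ hκ hL'
    exact ⟨ρ', τm, R₁, τ₁, τ₂, W, κ, Ψg, P, τn, Rc, κ', Ψa, hprof,
      ⟨hR, hτ, hW, hwall, hG1, hG2, hG3, hG4, hG5⟩, ⟨hτ₂, hκ, hL'⟩, hshc⟩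
  choose ρ' τm R₁ τ₁ τ₂ W κ Ψg P τn Rc κ' Ψa hprof hgap hloc hshc using key
  -- the relabelled decomposition and (B)
  have hN' : 0 < d'.N := by rw [hNN]; exact hN
  refine ⟨relabelEach d' P, R₀', (Relabel.relabelEach_charted d' P).trans hch, hN',
    Relabel.honestCore_relabelEach d' P R₀' hc', flatTubesClosed_relabelEach d' P hf',
    Relabel.distinctLabels_relabelEach d' P hdv', ?_⟩
  exact hB X D hD 𝒟 h𝒟 O d' R₀' hO' hc' hf' hdv' (tubeAnchoredR_of_clock d' R₀' hanch) hN' P ρ' τm R₁ τ₁ τ₂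
    τn W κ Rc κ' Ψg Ψa hprof hgap hloc hshc

end Summit.FinalStateConjecture.FinalStateConjecture.Theorems.GapDecaySuffices.V10

end
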